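import Summits.QuantumFields.BalabanUV.Beta.GAN24.OneStepConstraintAxialDelKVolumeEnds
import Summits.QuantumFields.BalabanUV.Beta.GAN24.OneStepConstraintAxialDelKLimit
import Literature.MathematicalPhysics.QuantumFieldTheory.Balaban1983to89.Beta.InfiniteVolumeRate

/-!
# `BalabanUV.Beta.GAN24.OneStepConstraintAxialDelKVolumeLimitDecay` — binder row G-an2-4 ∕ (CONV-C), routes C-R6° («VALUES») × R7 («TWO CURRENCIES») × pv09's B6 torus line × road P2's
# periodisation, PART 192: (CONV-C)'s TWO CLAUSES FOR THE INFINITE-VOLUME GAUGE-FIXED ONE-LOOP LETTER.  PART 184 gave ONE pair `(κ, C)` with `|𝒢_n(x,x′)| ≤ C·e^{−κ·tdist(par x, par x′)}` and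
# `|(𝒢_n − 𝒢_{n′})(x,x′)| ≤ C·n⁻²·e^{−κ·tdist(par x, par x′)}` on EVERY coarse torus; PART 191 named the infinite-volume limit kernel `𝒢_{n,∞}` on `ℤ^{d+1} × Fin (d+1)` along cubic volumes.
# Here the two are joined: at integer readings the block distance `tdist(par ŵ, par ŵ′)` is EVENTUALLY the `ℤ^{d+1}` sup-distance of the block coordinates `⌊w∕Lb⌋, ⌊w′∕Lb⌋` (the
# centred lift of a fixed integer vector on a large torus is the vector), so both clauses pass to the limit (`le_of_tendsto`): `|𝒢_{n,∞}(b,b′)| ≤ C·e^{−κ‖⌊w′∕Lb⌋ − ⌊w∕Lb⌋‖_∞}` and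
# `|𝒢_{n,∞}(b,b′) − 𝒢_{n′,∞}(b,b′)| ≤ C·n⁻²·e^{−κ‖⌊w′∕Lb⌋ − ⌊w∕Lb⌋‖_∞}` for all `1 ≤ n ≤ n′` — the repaired census-V195 letter ON `ℤ^{d+1}`: (UD) + (SR) + EL₂ in one statement, every
# dimension `d + 1 ≥ 2`, NO RESIDUAL HYPOTHESIS (unit b2b-balaban-gan24-p3, gen 61; v1)

NOT IN PRINT; OUR PROOF ([folklore] bookkeeping BY NAME over PART 184 `flucCov_DelK_axial_two_levels`, PART 191 (`exists_flucCov_DelK_axial_limitKernel`, `castT_fine_eq_rho`), PART 185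
`eventually_castT_eq_castT_iff`-style exact windows via the β-cell's `Beta.eventually_inWindow` ∕ `symmRep_intCast` ∕ `symmRep_eq_valMinAbs`, `VectorPropagatorLimit.castT_sub`, NE2's
`par_cpt_add_off`, Mathlib's `le_of_tendsto`; [Balaban1984PropagatorsII] (2.156) p. 250 («C*Δ_kC has the same exponential decay as Δ_k»), [King1986] Lemma 4.5 (4.38) p. 674 and
[Balaban1987RG1] p. 264 (after (1.21)) LOCATE the shapes; nothing printed is a hypothesis).
HONEST FRAMING (cell contract, verbatim): «discharging `BetaPertH` makes Bałaban's UV stability UNCONDITIONAL — a real constructive-QFT result; it is NOT the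
continuum limit and NOT the Clay problem.»  HONEST DEPENDENCY (verbatim): «continuum YM on T⁴ ⇐ BetaPertH ∧ nine spine estimates (0/9 proved); BetaPertH ⇐
(D1) ∧ (D4) ∧ CAP+tail; G-an2-4 gates asym, D1 and NE2/3/4.»

WHAT THIS FILE PROVES (0 sorry, 0 `def`):
* §1 (any `d`, any volume sequence `side t → ∞`) **`liftZ_castT_eventually`** (`liftZ ẑ = z` eventually), **`tdist_castT_eventually`** (`tdist ẑ ẑ′ = ‖z′ − z‖_∞` eventually),
  `par_castT_fine` (`par ŵ = ⌊w∕Lb⌋^`).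
* §2 **`exists_limitKernel_two_clauses`** — in dimension `d + 1 ≥ 2`, for every `Lb ≥ 1`, all `a, a′ > 0` and every cubic coarse volume sequence `s t → ∞`: `∃ κ C > 0` (PART 184's) such that for all
  `1 ≤ n ≤ n′` there are kernels `G, G′` on `ℤ^{d+1} × Fin (d+1)` with `𝒢_{n,t}((ŵ,μ),(ŵ′,μ′)) → G (w,μ) (w′,μ′)`, `𝒢_{n′,t}((ŵ,μ),(ŵ′,μ′)) → G′ (w,μ) (w′,μ′)`,
  `|G b b′| ≤ C·e^{−κ‖⌊w′∕Lb⌋ − ⌊w∕Lb⌋‖_∞}` and `|G b b′ − G′ b b′| ≤ C·(n²)⁻¹·e^{−κ‖⌊w′∕Lb⌋ − ⌊w∕Lb⌋‖_∞}`.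
WHAT IT IS NOT: a statement about Bałaban's `Δ^{(k)}(U)` with a background (first-order MODEL framing unchanged); the limit kernel's independence of the volume sequence is not asserted
(it holds — the limit is along every cubic sequence — but is not packaged); the loop contraction (ζ).  SUPPLIER work; NEVER «G-an2-4 closed»; NOT (CONV-C), NOT D1, NOT `BetaPertH`,
NOT continuum, NOT Clay.  Records: `HOME/b2b-balaban-gan24-p3/gen61/README.md`.
-/

noncomputable section

open scoped BigOperators ComplexConjugate Matrix
open Filter Topology Finset Matrix

namespace Summit.QuantumFields.BalabanUV.Beta.GAN24.OneStepConstraintAxialDelKVolumeLimitDecay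

open Literature.MathematicalPhysics.QuantumFieldTheory.Balaban1983to89
open Literature.MathematicalPhysics.QuantumFieldTheory.Balaban1983to89.B5Prop11Plancherel (Tor fine)
open Literature.MathematicalPhysics.QuantumFieldTheory.Balaban1983to89.B5RealFields (reM)
open Literature.MathematicalPhysics.QuantumFieldTheory.Balaban1983to89.B5G183RateTorus (cpt)
open Literature.MathematicalPhysics.QuantumFieldTheory.Balaban1983to89.B5G183RateTorusW (off)
open Literature.MathematicalPhysics.QuantumFieldTheory.Balaban1983to89.Beta (symmRep symmRep_intCast eventually_inWindow symmRep_eq_valMinAbs)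
open Literature.MathematicalPhysics.QuantumFieldTheory.Balaban1983to89.Beta.FreeLegDictionary (cubic)
open Literature.MathematicalPhysics.QuantumFieldTheory.Balaban1983to89.Beta.VectorTails (castT liftZ)
open Literature.MathematicalPhysics.QuantumFieldTheory.Balaban1983to89.Beta.VectorTailsCov (tdist)
open Literature.MathematicalPhysics.QuantumFieldTheory.Balaban1983to89.Beta.VectorPropagatorLimit (castT_sub)
open Literature.MathematicalPhysics.QuantumFieldTheory.Balaban1983to89.Beta.PoissonInterior (supNorm)
open Literature.MathematicalPhysics.QuantumFieldTheory.Balaban1983to89.Beta.CompositionSingular (flucCov)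
open Literature.MathematicalPhysics.QuantumFieldTheory.Balaban1983to89.Beta.BlockEffectiveAction (DelK)
open Summit.QuantumFields.BalabanUV.T4Continuum.BalabanLineAverage (QB)
open Summit.QuantumFields.BalabanUV.T4Continuum.BalabanAveragedTowerModes (par rem par_cpt_add_off)
open Summit.QuantumFields.BalabanUV.Beta.GAN24.OneStepConstraintBlockPresentation (tree_cpt_add_off)
open Summit.QuantumFields.BalabanUV.Beta.GAN24.OneStepConstraintAxialDelKLimit (flucCov_DelK_axial_two_levels)
open Summit.QuantumFields.BalabanUV.Beta.GAN24.OneStepConstraintAxialDelKVolumeEnds (castT_fine_eq_rho exists_flucCov_DelK_axial_limitKernel)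

variable {d : ℕ}

/-! ## §1 The block distance at integer readings is eventually the `ℤ^{d+1}` sup-distance -/

section Readings

variable {side : ℕ → ℕ} [∀ t, NeZero (side t)]

/-- **`liftZ_castT_eventually`** — along `side t → ∞`, the centred lift of the reading of a FIXED integer vector is eventually the vector: `liftZ ẑ_t = z` (the β-cell's window lemma
`symmRep_intCast` once `z` lies in the window). [folklore] -/
theorem liftZ_castT_eventually (hside : Tendsto side atTop atTop) (v : Fin d → ℤ) : ∀ᶠ t in atTop, liftZ (castT (cubic d (side t)) v) = v := by
  filter_upwards [eventually_inWindow hside v] with t ht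
  funext μ
  simp only [liftZ, castT]
  rw [← symmRep_eq_valMinAbs]
  exact symmRep_intCast (ht μ)

/-- **`tdist_castT_eventually`** — along `side t → ∞`, the torus sup-distance of two integer readings is eventually their `ℤ^d` sup-distance: `tdist ẑ ẑ′ = ‖z′ − z‖_∞`. [folklore] -/
theorem tdist_castT_eventually (hside : Tendsto side atTop atTop) (z z' : Fin d → ℤ) :
    ∀ᶠ t in atTop, tdist (castT (cubic d (side t)) z) (castT (cubic d (side t)) z') = supNorm (z' - z) := by
  filter_upwards [liftZ_castT_eventually hside (z' - z)] with t ht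
  unfold tdist
  rw [← castT_sub, ht]

end Readings

/-- `par ŵ = ⌊w∕Lb⌋^`: the block parent of the reading of an integer vector is the reading of its block coordinate (PART 191 `castT_fine_eq_rho` + NE2's `par_cpt_add_off`). [folklore] -/
theorem par_castT_fine (Lb : ℕ) [NeZero Lb] (M₁ : Fin (d + 1) → ℕ) [∀ μ, NeZero (M₁ μ)] (w : Fin (d + 1) → ℤ) :
    par 1 Lb M₁ (castT (fine (Lb * 1) M₁) w) = castT (fine 1 M₁) (fun ν => w ν / (Lb : ℤ)) := by
  rw [castT_fine_eq_rho Lb M₁ w, par_cpt_add_off]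

/-! ## §2 (CONV-C)'s two clauses for the infinite-volume gauge-fixed one-loop letter -/

section TwoClauses

variable (Lb : ℕ) [NeZero Lb] (a : ℝ) (ha : 0 < a) (s : ℕ → ℕ) [hs0 : ∀ t, NeZero (s t)]

/-- **`exists_limitKernel_two_clauses` — (UD) AND (SR) FOR THE INFINITE-VOLUME GAUGE-FIXED ONE-LOOP LETTER, NO RESIDUAL HYPOTHESIS**: in dimension `d + 1 ≥ 2`, for every blocking factor
`Lb ≥ 1`, all dummies `a, a′ > 0` and every cubic coarse volume sequence `s t → ∞` there are `κ, C > 0` (PART 184's, functions of `d, Lb, a′`) such that for all levels `1 ≤ n ≤ n′` the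
infinite-volume limit kernels `G = 𝒢_{n,∞}`, `G′ = 𝒢_{n′,∞}` of `flucCov (re Δ_n) (fromRows (re QB 1 Lb M_t) E_tree)` at fine integer bonds (PART 191) exist and satisfy, for all bonds `b = (w,μ)`,
`b′ = (w′,μ′)` of `ℤ^{d+1}`: `|G b b′| ≤ C·e^{−κ‖⌊w′∕Lb⌋ − ⌊w∕Lb⌋‖_∞}` and `|G b b′ − G′ b b′| ≤ C·(n²)⁻¹·e^{−κ‖⌊w′∕Lb⌋ − ⌊w∕Lb⌋‖_∞}` — King's (4.38) shape (`θ^k = Lb^{−2k}` along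
`n = Lb^k`) for the `ℤ^{d+1}` kernels. [folklore] -/
theorem exists_limitKernel_two_clauses (hd : 1 ≤ d) (hs : Tendsto s atTop atTop) {a' : ℝ} (ha' : 0 < a') :
    ∃ κ C : ℝ, 0 < κ ∧ 0 < C ∧ ∀ (n n' : ℕ) [NeZero n] [NeZero n'] (hn : 1 ≤ n) (hn' : 1 ≤ n'), n ≤ n' →
      ∃ G G' : ((Fin (d + 1) → ℤ) × Fin (d + 1)) → ((Fin (d + 1) → ℤ) × Fin (d + 1)) → ℝ,
        (∀ (w : Fin (d + 1) → ℤ) (μ : Fin (d + 1)) (w' : Fin (d + 1) → ℤ) (μ' : Fin (d + 1)),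
          Tendsto (fun t => flucCov (reM (DelK n hn (fine (Lb * 1) (cubic (d + 1) (s t))) a ha)) (Matrix.fromRows (reM (QB 1 Lb (cubic (d + 1) (s t)))) (fun (t' : {x : Tor (fine (Lb * 1) (cubic (d + 1) (s t))) × Fin (d + 1) // (∀ ν, ν < x.2 → ((rem 1 Lb (cubic (d + 1) (s t)) x.1 ν : ℕ)) = 0) ∧ ((rem 1 Lb (cubic (d + 1) (s t)) x.1 x.2 : ℕ)) + 1 < Lb}) (x : Tor (fine (Lb * 1) (cubic (d + 1) (s t))) × Fin (d + 1)) => if x = (Function.Embedding.subtype (fun x : Tor (fine (Lb * 1) (cubic (d + 1) (s t))) × Fin (d + 1) => (∀ ν, ν < x.2 → ((rem 1 Lb (cubic (d + 1) (s t)) x.1 ν : ℕ)) = 0) ∧ ((rem 1 Lb (cubic (d + 1) (s t)) x.1 x.2 : ℕ)) + 1 < Lb)) t' then (1 : ℝ) else 0)) ((castT (fine (Lb * 1) (cubic (d + 1) (s t))) w, μ) : Tor (fine (Lb * 1) (cubic (d + 1) (s t))) × Fin (d + 1)) ((castT (fine (Lb * 1) (cubic (d + 1) (s t))) w', μ') :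 Tor (fine (Lb * 1) (cubic (d + 1) (s t))) × Fin (d + 1))) atTop (𝓝 (G (w, μ) (w', μ')))) ∧
        (∀ (w : Fin (d + 1) → ℤ) (μ : Fin (d + 1)) (w' : Fin (d + 1) → ℤ) (μ' : Fin (d + 1)),
          Tendsto (fun t => flucCov (reM (DelK n' hn' (fine (Lb * 1) (cubic (d + 1) (s t))) a ha)) (Matrix.fromRows (reM (QB 1 Lb (cubic (d + 1) (s t)))) (fun (t' : {x : Tor (fine (Lb * 1) (cubic (d + 1) (s t))) × Fin (d + 1) // (∀ ν, ν < x.2 → ((rem 1 Lb (cubic (d + 1) (s t)) x.1 ν : ℕ)) = 0) ∧ ((rem 1 Lb (cubic (d + 1) (s t)) x.1 x.2 : ℕ)) + 1 < Lb}) (x : Tor (fine (Lb * 1) (cubic (d + 1) (s t))) × Fin (d + 1)) => if x = (Function.Embedding.subtype (fun x : Tor (fine (Lb * 1) (cubic (d + 1) (s t))) × Fin (d + 1) => (∀ ν, ν < x.2 → ((rem 1 Lb (cubic (d + 1) (s t)) x.1 ν : ℕ)) = 0) ∧ ((rem 1 Lb (cubic (d + 1) (s t)) x.1 x.2 : ℕ))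 + 1 < Lb)) t' then (1 : ℝ) else 0)) ((castT (fine (Lb * 1) (cubic (d + 1) (s t))) w, μ) : Tor (fine (Lb * 1) (cubic (d + 1) (s t))) × Fin (d + 1)) ((castT (fine (Lb * 1) (cubic (d + 1) (s t))) w', μ') : Tor (fine (Lb * 1) (cubic (d + 1) (s t))) × Fin (d + 1))) atTop (𝓝 (G' (w, μ) (w', μ')))) ∧
        ∀ (w : Fin (d + 1) → ℤ) (μ : Fin (d + 1)) (w' : Fin (d + 1) → ℤ) (μ' : Fin (d + 1)),
          |G (w, μ) (w', μ')| ≤ C * Real.exp (-(κ * (supNorm ((fun ν => w' ν / (Lb : ℤ)) - (fun ν => w ν / (Lb : ℤ))) : ℝ))) ∧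
          |G (w, μ) (w', μ') - G' (w, μ) (w', μ')| ≤ C * ((n : ℝ) ^ 2)⁻¹ * Real.exp (-(κ * (supNorm ((fun ν => w' ν / (Lb : ℤ)) - (fun ν => w ν / (Lb : ℤ))) : ℝ))) := by
  obtain ⟨κ, C, hκ, hC, H⟩ := flucCov_DelK_axial_two_levels Lb a ha hd ha'
  refine ⟨κ, C, hκ, hC, fun n n' _ _ hn hn' hnn' => ?_⟩
  obtain ⟨G, hG⟩ := exists_flucCov_DelK_axial_limitKernel Lb n hn a ha s hd hs ha'
  obtain ⟨G', hG'⟩ := exists_flucCov_DelK_axial_limitKernel Lb n' hn' a ha s hd hs ha'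
  refine ⟨G, G', hG, hG', fun w μ w' μ' => ?_⟩
  have hside : Tendsto (fun t => 1 * s t) atTop atTop := by simpa only [one_mul] using hs
  -- the block distance of the two fine integer bonds is eventually the `ℤ^{d+1}` sup-distance of their block coordinates
  have hev : ∀ᶠ t in atTop, (tdist (par 1 Lb (cubic (d + 1) (s t)) (castT (fine (Lb * 1) (cubic (d + 1) (s t))) w))
      (par 1 Lb (cubic (d + 1) (s t)) (castT (fine (Lb * 1) (cubic (d + 1) (s t))) w')) : ℝ)
        = (supNorm ((fun ν => w' ν / (Lb : ℤ)) - (fun ν => w ν / (Lb : ℤ))) : ℝ) := by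
    filter_upwards [tdist_castT_eventually (d := d + 1) (side := fun t => 1 * s t) hside (fun ν => w ν / (Lb : ℤ)) (fun ν => w' ν / (Lb : ℤ))] with t ht
    rw [par_castT_fine, par_castT_fine]
    exact_mod_cast ht
  constructor
  · refine le_of_tendsto (hG w μ w' μ').abs ?_
    filter_upwards [hev] with t ht
    rw [← ht]
    exact (H (cubic (d + 1) (s t)) n n' hn hn' hnn' _ _).1
  · rw [abs_sub_comm]
    refine le_of_tendsto ((hG' w μ w' μ').sub (hG w μ w' μ')).abs ?_
    filter_upwards [hev] with t ht
    rw [← ht]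
    have h2 := (H (cubic (d + 1) (s t)) n n' hn hn' hnn' ((castT (fine (Lb * 1) (cubic (d + 1) (s t))) w, μ) : Tor (fine (Lb * 1) (cubic (d + 1) (s t))) × Fin (d + 1)) ((castT (fine (Lb * 1) (cubic (d + 1) (s t))) w', μ') : Tor (fine (Lb * 1) (cubic (d + 1) (s t))) × Fin (d + 1))).2
    rwa [Matrix.sub_apply] at h2

end TwoClauses

end Summit.QuantumFields.BalabanUV.Beta.GAN24.OneStepConstraintAxialDelKVolumeLimitDecay

end
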